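import Summits.BirchSwinnertonDyer.BirchSwinnertonDyer.Theorems.ManinLocalTwoThreeShimuraFiveRootNumber
import Summits.BirchSwinnertonDyer.BirchSwinnertonDyer.Theorems.ManinLocalTwoThreeShimuraFiveResidualHolds
import HarnessLib

/-!
# The `25 ∣ N` residual of «`5 ∣ [Λ₀:Λ₁] ⟹ N = 11`» is a local root-number law at `5`
# (cell bsd-f2-manin, es g43 ROAD δ; MEMO-es §66.8)

Cell bsd-f2-manin, seat es (planner), gen 43.  Typed rows over tree declarations; every row is an `@[conjecture] def … : Prop`.
`¬ ShimuraIndexPrimeTo 5 f` = «`5 ∣ [Λ₀(f):Λ₁(f)]`»; `v₅` = the place of `ℤ` under `5` (`Rat.HeightOneSpectrum.primesEquiv`).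
* E-es-236 `ShimuraFiveSignAtFive` — THEOREM (`shimuraFiveSignAtFive_holds`): for a lattice-optimal `X₀(N)`-datum of a minimal curve with
  `5 ∣ [Λ₀:Λ₁]` and `5 ∣ N`, the Atkin–Lehner sign at `5` is not `−1` (THEOREM AL + ROAD β/γ: the unique sign-`−1` prime is `11`).
* E-es-237 `ShimuraFiveRootNumberAtFive` — THEOREM modulo the two NAMED FACTS displayed as hypotheses (Carayol `IsNewformOf.level_eq_conductorNorm`,
  Kellock–Dokchitser/Deligne `atkinLehnerEigenvalueAt_eq_localRootNumberAt`) (`shimuraFiveRootNumberAtFive_holds`): then Rohrlich's `w₅(W₀) ≠ −1`,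
  i.e. (tree definition `WeierstrassCurve.localRootNumber`) at `25 ∣ N` the curve is potentially multiplicative or has `e ∈ {2, 6}` at `5`.
* E-es-235 `SplitFiveTorsionRootNumberLaw` — CONJECTURAL LOCAL LAW L5 (paper proof sketched in MEMO-es §66.8 from Serre 1972 Prop. 11–12, Tate
  curves and the height-2 formal group at `j = 0`; not formalised): a rational point of order `5` + `W[5]` fixed by `Gal(ℚ̄/ℚ(μ₅))` + additive at `5`
  ⟹ `w₅(W) = −1` (semistability defect `e = 4`, Kodaira `III`/`III*`).
* EDGES (`shimuraFiveNoTwentyFive_of_splitFiveTorsionRootNumberLaw`, `shimuraFiveOnlyAtEleven_of_splitFiveTorsionRootNumberLaw`):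
  E-es-235 ∧ Carayol ∧ (`λ_p = w_p`) ⟹ E-es-227 `ShimuraFiveNoTwentyFive`; and with E-es-228 (Byeon–Kim range) ⟹ E-es-224 `ShimuraFiveOnlyAtEleven`.
Census = BC5 witness of E-es-235 (HOME/es/g43/L5-family-check-g43.txt, script l5_family_check.py): the `5Cs.1.1` family `E'_s = E_{s⁵}/⟨(0,0)⟩`
(`s = 1, 2, 3, −2, 3/2, −3, 1/4` ↦ `11a1, 1342c2, 33825be2, 550k2, 165066d2, 185163a2, 192698c2`), `s = u/v`, `|u|, v ≤ 40`, 1958 parameters: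
additive at `5` ⟺ `s ≡ 3 (mod 5)` (318/1958), all 318 of Kodaira type `III` (`v₅(Δ_min) = 3`, `e = 4`, `w₅ = (−2|5) = −1`), 0 exceptions; the
two `5Cs.1.1` curves of ecdata with `25 ∣ N ≤ 5·10⁵` (`550k2`, `33825be2`; E20-KP57 d79bad314106d9ba) are `s = −2, 3`.  BSD is not proved here;
C2/C3 untouched; E-es-227/224 remain OPEN (conditional on L5).
[cite: Rohrlich1993Compositio, Prop. 2] [cite: KellockDokchitser2023, Rem. 2.2] [cite: Carayol1986] [cite: Serre1972, Prop. 11, Prop. 12]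
[cite: LingOesterle1991, Thm. 6] [cite: Vatsal2005, Rem. 1.8] [cite: ByeonKim2014, Thm. 1.1]
-/

set_option autoImplicit false

noncomputable section

open scoped MatrixGroups ModularForm

open CongruenceSubgroup Complex WeierstrassCurve Literature.NumberTheory.EllipticCurves
  Literature.NumberTheory.EllipticCurves.ModularForms IsDedekindDomain
open Summit.BirchSwinnertonDyer.Rank1Residual.ManinAdditive Summit.BirchSwinnertonDyer.Rank1Residual.ManinAdditive.KatoCurve
open Summit.BirchSwinnertonDyer.BirchSwinnertonDyer.Theorems.ManinLocalTwoThree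

namespace Summit.BirchSwinnertonDyer.Rank1Residual.ManinAdditive.EsG43

/-- **E-es-236 `ShimuraFiveSignAtFive`** (THEOREM: `shimuraFiveSignAtFive_holds`).  For a lattice-optimal `X₀(N)`-datum of a minimal curve
with `5 ∣ [Λ₀(f):Λ₁(f)]` and `5 ∣ N`: the Atkin–Lehner sign at `5` is not `−1` (the unique sign-`−1` prime of the level is `11`).
[cite: LingOesterle1991, Thm. 6] [cite: AtkinLehner1970, Thm. 3] [cite: Vatsal2005, Rem. 1.8] -/
@[conjecture]
def ShimuraFiveSignAtFive : Prop :=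
  ∀ (W₀ : WeierstrassCurve ℚ) [W₀.IsElliptic] [W₀.IsGloballyMinimal] {N : ℕ} [NeZero N] (D₀ : ModularParametrizationData W₀ N),
    (∀ z ∈ D₀.L.lattice, ∃ w ∈ periodLattice D₀.f, z = D₀.c * w) → ¬ ShimuraIndexPrimeTo 5 D₀.f → 5 ∣ N →
    atkinLehnerEigenvalueAt D₀.f 5 ≠ -1

/-- **E-es-237 `ShimuraFiveRootNumberAtFive`** (THEOREM modulo the displayed named facts: `shimuraFiveRootNumberAtFive_holds`).  For a
lattice-optimal `X₀(N)`-datum of a minimal curve with `5 ∣ [Λ₀(f):Λ₁(f)]` and `5 ∣ N`, granted Carayol (`N = N_{W₀}`) and `λ_p(f) = w_p(W₀)`: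
Rohrlich's local root number `w₅(W₀) ≠ −1` — so at `25 ∣ N` the curve is potentially multiplicative or has `e ∈ {2, 6}` at `5`.
[cite: Rohrlich1993Compositio, Prop. 2] [cite: KellockDokchitser2023, Rem. 2.2] [cite: Carayol1986] -/
@[conjecture]
def ShimuraFiveRootNumberAtFive : Prop :=
  ∀ (W₀ : WeierstrassCurve ℚ) [W₀.IsElliptic] [W₀.IsGloballyMinimal] {N : ℕ} [NeZero N] (D₀ : ModularParametrizationData W₀ N),
    IsNewformOf.level_eq_conductorNorm (N := N) → W₀.atkinLehnerEigenvalueAt_eq_localRootNumberAt →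
    (∀ z ∈ D₀.L.lattice, ∃ w ∈ periodLattice D₀.f, z = D₀.c * w) → ¬ ShimuraIndexPrimeTo 5 D₀.f → 5 ∣ N →
    W₀.localRootNumberAt ((Rat.HeightOneSpectrum.primesEquiv (R := ℤ)).symm ⟨5, by norm_num⟩) ≠ -1

/-- **E-es-235 `SplitFiveTorsionRootNumberLaw`** (CONJECTURAL local law L5; paper proof MEMO-es §66.8, census: the `5Cs.1.1` family, 318/318
additive fibres of Kodaira type `III`).  An elliptic `W/ℚ` with a rational point of order `5`, whose `5`-torsion is fixed pointwise by every
`σ ∈ Γ_ℚ` fixing `μ₅` (so `W[5] ≅ ℤ/5 ⊕ μ₅`), and which is additive at `5`, has Rohrlich local root number `w₅(W) = −1` (equivalently: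
potentially good at `5` with `e ∈ {3, 4}`; in fact `e = 4`).  Why it might fail: only through an error in the local analysis of `e = 6`
(height-2 formal group over `ℚ₅^{nr}(5^{1/6})`); the `e = 2` and potentially multiplicative exclusions are inertia-character identities.
[cite: Rohrlich1993Compositio, Prop. 2] [cite: Serre1972, Prop. 11, Prop. 12] -/
@[conjecture]
def SplitFiveTorsionRootNumberLaw : Prop :=
  ∀ (W : WeierstrassCurve ℚ) [W.IsElliptic], (∃ t : W.toAffine.Point, addOrderOf t = 5) →
    (∀ σ : Field.absoluteGaloisGroup ℚ, (∀ ζ : AlgebraicClosure ℚ, ζ ^ 5 = 1 → σ • ζ = ζ) → ∀ T : W.geomTorsion 5, σ • T = T) →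
    W.HasAdditiveReductionAt ((Rat.HeightOneSpectrum.primesEquiv (R := ℤ)).symm ⟨5, by norm_num⟩) →
    W.localRootNumberAt ((Rat.HeightOneSpectrum.primesEquiv (R := ℤ)).symm ⟨5, by norm_num⟩) = -1

/-- E-es-236 is a theorem. -/
theorem shimuraFiveSignAtFive_holds : ShimuraFiveSignAtFive :=
  fun W₀ _ _ _ _ D₀ hopt hS h5N ↦ ShimuraFive.atkinLehnerEigenvalueAt_five_ne_neg_one W₀ D₀ hopt hS h5N

/-- E-es-237 is a theorem (the named facts are its displayed hypotheses). -/
theorem shimuraFiveRootNumberAtFive_holds : ShimuraFiveRootNumberAtFive :=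
  fun W₀ _ _ _ _ D₀ hC hF1 hopt hS h5N ↦ ShimuraFive.localRootNumberAt_five_ne_neg_one W₀ D₀ hopt hS hC hF1 h5N

/-- **EDGE: E-es-235 ∧ Carayol ∧ (`λ_p = w_p`) ⟹ E-es-227.**  The local law L5 closes the `25 ∣ N` residual of E-es-224, modulo the two named
facts. [cite: Rohrlich1993Compositio, Prop. 2] [cite: KellockDokchitser2023, Rem. 2.2] [cite: Carayol1986] -/
theorem shimuraFiveNoTwentyFive_of_splitFiveTorsionRootNumberLaw (hL5 : SplitFiveTorsionRootNumberLaw)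
    (hC : ∀ (N : ℕ) [NeZero N], IsNewformOf.level_eq_conductorNorm (N := N))
    (hF1 : ∀ W : WeierstrassCurve ℚ, W.atkinLehnerEigenvalueAt_eq_localRootNumberAt) : ShimuraFiveNoTwentyFive :=
  fun W₀ _ _ N _ D₀ hopt hS ↦ ShimuraFive.not_twentyfive_dvd_of_splitFiveTorsionRootNumberLaw W₀ D₀ hopt hS (hC N) (hF1 W₀)
    (hL5 W₀)

/-- **EDGE: E-es-235 ∧ E-es-228 ∧ Carayol ∧ (`λ_p = w_p`) ⟹ E-es-224** («`5 ∣ [Λ₀:Λ₁] ⟹ N = 11`»).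
[cite: ByeonKim2014, Thm. 1.1] [cite: Rohrlich1993Compositio, Prop. 2] -/
theorem shimuraFiveOnlyAtEleven_of_splitFiveTorsionRootNumberLaw (hL5 : SplitFiveTorsionRootNumberLaw)
    (hC : ∀ (N : ℕ) [NeZero N], IsNewformOf.level_eq_conductorNorm (N := N))
    (hF1 : ∀ W : WeierstrassCurve ℚ, W.atkinLehnerEigenvalueAt_eq_localRootNumberAt) (hsq : ShimuraFiveSquarefreeOnlyAtEleven) :
    ShimuraFiveOnlyAtEleven :=
  ShimuraFiveResidual.shimuraFiveOnlyAtEleven_of_residuals (shimuraFiveNoTwentyFive_of_splitFiveTorsionRootNumberLaw hL5 hC hF1) hsq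

end Summit.BirchSwinnertonDyer.Rank1Residual.ManinAdditive.EsG43

end
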